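import Mathlib

/-! # RankLevelSetHallLevelIndepModel — THE ARITHMETIC ITEM (LLI-model): THE INTERVAL HALL INEQUALITIES OF THE
LEVEL-WISE LYM FORM ON INDEPENDENT SETS, ON THE MODEL FAMILY (night-1 g23, attempt 2; dossier §35.9(d), §35.10; a
statement of record, NOT asserted beyond the three instances proved here)

The MODEL family `T_{q+k}(U_{q,F} ⊕ free D)` (`#F = q + m`, `#D = u + k`, `u = q − m`, rank `p = q + k`, `n = 2q + k`,
the tight layer) at the rank level `t = q + s`, `1 ≤ s ≤ k − 1`, for the form (LLI) of `RankLevelSetHallLevelIndep`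
(only INDEPENDENT `t`-sets count). By the `S_F × S_D` symmetry the Hall LP is a TRANSPORTATION problem on types:
  · member types `i = #(Z ∩ F) ∈ [m, q]` (`i ≥ m` is co-spanning), `N_Z(i) = C(q+m, i)·C(u+k, q−i)`, demand
    `C(q+k, s)/C(q+s, s)` (= `C(n,t)/C(n,q)`) each;
  · set types `a = #(S ∩ F) ∈ [m, q]` (`a ≤ q` is independence; `a ≥ m` is «contains a member»),
    `N_S(a) = C(q+m, a)·C(u+k, q+s−a)`, capacity `1` each;
  · adjacency `a − s ≤ i ≤ a` — the Boolean pattern of `q`-sets inside `t`-sets on the two-part ground set `F ∪ D`,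
    with the member types `i < m` and the set types `a > q` REMOVED (a restricted Boolean LYM).
Every neighbourhood is an interval, so Hall's condition reduces to the intervals `[i₁, i₂] ⊆ [m, q]`:
  (LLI-model)  C(q+k,s)·Σ_{i=i₁}^{i₂} N_Z(i) ≤ C(q+s,s)·Σ_{a=i₁}^{min(i₂+s, q)} N_S(a).
For `i₂ + s ≤ q` it IS the Boolean LYM (nothing removed on the right); the content is the truncated intervals
`i₂ + s > q`, and on every instance computed the tightest interval is the FULL one `[m, q]` (all members), e.g.
ratio `1.000536` at `(q,k,m,s) = (11,9,1,8)` — in tail form `P(H_q < m) ≥ P(H_t < m) + P(H_t > q)` for the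
hypergeometric F-counts `H_r` of a random `r`-subset (the removed members against the removed sets).
Census: `q ≤ 20`, `k ≤ 8`, all `m`, `s`, all intervals: 297,500 instances, 0 failures (lliint.py); kit j299031 extends
to `q ≤ 60`, `k ≤ 12`. The matroid half (type counts = set counts on the model; the symmetrisation) is the paper
computation of §35.9(d), not a theorem here; what is proved below: the definitions and the global instances at the two
cells where the flat-excess rule dies and at one `q < k` cell. Mathlib only; every declaration has a docstring. -/

namespace PercRepro

/-- **The member count of F-count `i` on the model**: `N_Z(i) = C(q+m, i)·C(q−m+k, q−i)` (`i` elements in the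
rank-`q` flat `F` of `q + m` elements, `q − i` in the free part `D` of `q − m + k` elements). -/
def lliMembers (q k m i : ℕ) : ℕ := (q + m).choose i * (q - m + k).choose (q - i)

/-- **The count of independent `(q+s)`-sets of F-count `a` on the model**: `N_S(a) = C(q+m, a)·C(q−m+k, q+s−a)`. -/
def lliSets (q k m s a : ℕ) : ℕ := (q + m).choose a * (q - m + k).choose (q + s - a)

/-- **The interval inequality of (LLI-model)** for the interval `[i₁, i₂]` of member types (`i = i₁ + r`):
`C(q+k,s)·Σ_{i=i₁}^{i₂} N_Z(i) ≤ C(q+s,s)·Σ_{a=i₁}^{min(i₂+s,q)} N_S(a)`. -/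
def LLIModelInterval (q k m s i₁ i₂ : ℕ) : Prop :=
  ((q + k).choose s : ℚ) * (∑ r ∈ Finset.range (i₂ - i₁ + 1), (lliMembers q k m (i₁ + r) : ℚ)) ≤
    ((q + s).choose s : ℚ) * (∑ r ∈ Finset.range (min (i₂ + s) q - i₁ + 1), (lliSets q k m s (i₁ + r) : ℚ))

/-- **THE ARITHMETIC ITEM (LLI-model)** (a `Prop`, NOT asserted): every interval inequality, for every `q ≥ 1`,
`k ≥ 2`, `m ≤ q`, `1 ≤ s < k`, `m ≤ i₁ ≤ i₂ ≤ q`. With the symmetrisation of §35.9(d) it is (LLI) — hence the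
level-wise form — at every level of every cell of the model family. -/
def LLIModelIneq : Prop :=
  ∀ q k m s i₁ i₂ : ℕ, 1 ≤ q → 2 ≤ k → m ≤ q → 1 ≤ s → s < k → m ≤ i₁ → i₁ ≤ i₂ → i₂ ≤ q →
    LLIModelInterval q k m s i₁ i₂

/-- **The global (all-members) instance at `(q,k,m,s) = (11,9,1,8)`** — the top level of the cell `(20,11)` where the
flat-excess rule dies: the tightest interval on that instance (ratio `1.000536`). -/
theorem lliModelInterval_11_9_1_8 : LLIModelInterval 11 9 1 8 1 11 := by
  unfold LLIModelInterval lliMembers lliSets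
  simp only [show (11 : ℕ) - 1 + 1 = 11 from rfl, show min (11 + 8) 11 - 1 + 1 = 11 from rfl,
    show (11 : ℕ) - 1 + 9 = 19 from rfl, Finset.sum_range_succ, Finset.sum_range_zero]
  norm_num [Nat.choose]

/-- **The global instance at `(16,10,5,9)`** (the second minimum of the flat-excess rule; ratio `1.0070`). -/
theorem lliModelInterval_16_10_5_9 : LLIModelInterval 16 10 5 9 5 16 := by
  unfold LLIModelInterval lliMembers lliSets
  simp only [show (16 : ℕ) - 5 + 1 = 12 from rfl, show min (16 + 9) 16 - 5 + 1 = 12 from rfl,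
    show (16 : ℕ) - 5 + 10 = 21 from rfl, Finset.sum_range_succ, Finset.sum_range_zero]
  norm_num [Nat.choose]

/-- **The global instance at `(7,10,4,9)`** (a `q < k` cell where the coloop rule dies; ratio `1.4054`). -/
theorem lliModelInterval_7_10_4_9 : LLIModelInterval 7 10 4 9 4 7 := by
  unfold LLIModelInterval lliMembers lliSets
  simp only [show (7 : ℕ) - 4 + 1 = 4 from rfl, show min (7 + 9) 7 - 4 + 1 = 4 from rfl,
    show (7 : ℕ) - 4 + 10 = 13 from rfl, Finset.sum_range_succ, Finset.sum_range_zero]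
  norm_num [Nat.choose]

/-! ## CORRECTION (night-1 g23, attempt 2, 05:2xZ; dossier §35.12′)

The docstrings above say that on the model the Hall condition of the level form «reduces to the intervals of member
types» because every set type is adjacent to an interval of types. That inference is not valid in general: the interval
reduction of Hall's condition needs the vertices being matched (the member types) to have interval neighbourhoods, not
the set types; a union of two runs of types can have a smaller neighbourhood-to-size ratio than every interval. What is
true: the symmetrisation reduces Hall to unions of whole types (arbitrary subsets of `[0, u]`), and every interval
inequality is a NECESSARY condition. So `LLIModelIneq` (all intervals) is implied by (LLI) on the model, but the converse
is an unproved claim (exact type max-flows over all type-unions find no non-interval union tighter than every interval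
on `q ≤ 16`, `k ≤ 8`; kit j299494 extends the exact check to `q ≤ 80`, `k ≤ 12`). Nothing proved in this file depends on
the claim. -/

end PercRepro
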